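import Summits.MatrixMultiplication.OmegaCensus.SmallFormats.MatMul22nRankGF7Slack6FlatMain
import HarnessLib

/-!
# ω-census family (a): slack-6 certificate replay — MAIN CHECK (bucket completeness + level-1 expansion), file 14 of 114

Cell `pub-omega` (unit `pub-omega-tensor-g18`, `pub-omega-tensor-g19`), topic `Summits/MatrixMultiplication/OmegaCensus` (sub-folder `SmallFormats`).
Framing (verbatim): lottery ticket; floor = certified bounds/negative ranges. HONEST FRAMING: machine-generated kernel replay
(`pub-omega-tensor-g19/code/py/gen6_runs19.py`, from tensor g18's `gen6_runs18.py`): `LanesOK6 h 0 3692` (every lane of the total plane passes `laneOK6`) for the elements `37 ≤ h < 40` of `PGL₂(7)` (lane pieces `mainOK6K` (flat lane checker, literal plane) of ≤ 2400 level-1 loop nodes, 3367 in this file, glued by `lanesOK6_of_piece` / `lanesOK6_append`). Soundness is in `MatMul22nRankGF7Slack6SearchSound` /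
`MatMul22nRankGF7Slack6SearchFinal`; nothing here is progress on `ω`.
-/

namespace Summit.MatrixMultiplication.OmegaCensus.SmallFormats

set_option Elab.async false

set_option maxRecDepth 100000 in
set_option maxHeartbeats 400000000 in
/-- Element `37`: lanes `0 ≤ c < 3692` of the total plane pass (990 level-1 loop search nodes). -/
theorem mainOK6K_37_0 : mainOK6K 37 0 3692 = true := by decide +kernel

/-- **All 3 692 lanes of element `37` pass** (1 pieces; 990 loop search nodes). -/
theorem lanesOK6_h37 : LanesOK6 37 0 3692 := (lanesOK6_of_pieceK mainOK6K_37_0)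

set_option maxRecDepth 100000 in
set_option maxHeartbeats 400000000 in
/-- Element `38`: lanes `0 ≤ c < 3692` of the total plane pass (1341 level-1 loop search nodes). -/
theorem mainOK6K_38_0 : mainOK6K 38 0 3692 = true := by decide +kernel

/-- **All 3 692 lanes of element `38` pass** (1 pieces; 1341 loop search nodes). -/
theorem lanesOK6_h38 : LanesOK6 38 0 3692 := (lanesOK6_of_pieceK mainOK6K_38_0)

set_option maxRecDepth 100000 in
set_option maxHeartbeats 400000000 in
/-- Element `39`: lanes `0 ≤ c < 3692` of the total plane pass (1036 level-1 loop search nodes). -/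
theorem mainOK6K_39_0 : mainOK6K 39 0 3692 = true := by decide +kernel

/-- **All 3 692 lanes of element `39` pass** (1 pieces; 1036 loop search nodes). -/
theorem lanesOK6_h39 : LanesOK6 39 0 3692 := (lanesOK6_of_pieceK mainOK6K_39_0)

/-- **MAIN CHECK lanes for `37 ≤ · < 40`** (this file). -/
theorem lanesOK6_runM_14 : ∀ x, 37 ≤ x → x < 40 → LanesOK6 x 0 3692 := by
  intro x _h1 h2
  by_cases g38 : x < 38
  · have e : x = 37 := by omega
    subst e; exact lanesOK6_h37
  by_cases g39 : x < 39
  · have e : x = 38 := by omega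
    subst e; exact lanesOK6_h38
  have e : x = 39 := by omega
  subst e; exact lanesOK6_h39

end Summit.MatrixMultiplication.OmegaCensus.SmallFormats
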